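import Mathlib.Data.Int.Interval
import Literature.MathematicalPhysics.QuantumLattice.LatticeGaugeDLR
import Literature.MathematicalPhysics.QuantumLattice.YangMillsClassical
import HarnessLib

-- provenance: harness21/H21/H21/Prelude/QLatticeAQFT/BalabanRG.lean @ 96a2136 (interim HEAD d8f2665); M5 mechanical rewrite
/-!
# Bałaban's block renormalisation group for lattice gauge theories (schematic)

Trunk G13 (`QLatticeAQFT`), prelude item A18 `BalabanRG` (notion `block_rg_effective_density`;
tier L, the only item of the outline with `allow_stub`). Families served: `constructive-qft`
(cqft.S20 `BalabanUVStability3/4`, cqft.S21 `MagnenRivasseauSeneorYM4`, both schematic over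
`BlockRGScheme`).

## Content

The honest, computable core of Bałaban's block-spin transformation for lattice gauge fields
(T. Bałaban, CMP 95 (1984) §1, CMP 98 (1985) §1):

* `blockMap M : Site d → Site d`, `x ↦ ⌊x / M⌋` coordinatewise (the block of side `M`
  containing `x`), its section `blockBase M y = M y` (the distinguished corner of the block `y`),
  the block `blockSites M y` (a `Finset` of `M ^ d` sites), `coarseEdge M`, and the fine edges
  `fineEdges M Λ` lying over a finite set `Λ` of coarse edges;
* `blockLine M b`: the `M` fine edges on the straight line from `M y` to `M y + M eᵢ`
  representing the coarse edge `b = (y, i)`, and the *axial-gauge block link variable*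
  `axialBlockHolonomy M U b = U(My, i) U(My + eᵢ, i) ⋯ U(My + (M-1)eᵢ, i)` (Bałaban CMP 95
  (1984) (1.4)–(1.6): in the axial gauge inside blocks the block average of a gauge field is the
  parallel transport along the straight line joining block centres);
* running couplings `RunningCouplings := ℕ → ℝ` and the window condition `InWindow g γ k`
  (`0 < g_j ≤ γ` for `j ≤ k`; Bałaban CMP 109 (1987) (0.3), CMP 122 (1989) Thm. 1);
* the small-field region `smallFieldRegion ρ P ε = {U | ∀ p ∈ P, N - Re tr ρ(U_p) ≤ ε}`
  (Bałaban CMP 109 (1987) §1, (1.10): `|U(∂p) - 1| < ε`; we use the gauge-invariant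
  `N - Re tr ρ(U_p) = ½ ‖ρ(U_p) - 1‖²_{HS}` of A9 `plaquetteObs`).

The hypothesis part: `structure BlockRGScheme d N G` bundles the block size `M`, the
representation `ρ`, the running couplings and the sequence of *effective densities*
`effDensity k Λ V` (the density after `k` block RG steps, in the finite coarse edge volume `Λ`,
as a function of the coarse field `V`), with the honest starting point
`effDensity 0 Λ U = exp (-(g 0)⁻² S_Λ(U))` (Wilson action of A9 `wilsonBoundaryAction`).
The RG recursion
`effDensity (k+1) Λ V = ∫ ∏_{b ∈ Λ} δ(V_b⁻¹ (axialBlockHolonomy M U)_b) effDensity k Λ' U dU`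
(Bałaban CMP 109 (1987) (0.1)–(0.2), CMP 116 (1988) (1)–(3); Dimock arXiv:1108.1335 §1.2
(1)–(6) for the scalar analogue) together with its small/large-field decomposition is **not**
transcribed in v0: it is the `STUB(v0)` of this item, recorded in the docstring of
`BlockRGScheme.effDensity`; a future worker transcribes the displays named there. What we do
provide is the free-boundary pushforward form of one RG step as a definition,
`IsBlockRGStepOf M ρk ρk1 Λ` (the image of `ρk · Haar^{fineEdges}` under `axialBlockHolonomy M`
is `ρk1 · Haar^{Λ}`), so that the recursion can later be imposed as a hypothesis without
changing the structure.

Finally `HasUVStabilityBounds sch c C k` / `HasUVStability sch k` express Bałaban's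
ultraviolet stability bounds `exp (-c |Λ|) ≤ effDensity j Λ V ≤ exp (C |Λ|)` for `j ≤ k`
(Bałaban CMP 102 (1985) Thm. 1 (d = 3), CMP 122 (1989) Thm. 1 (d = 4)).

## Design choices

* Everything lives on `ℤ^d` (A9 `Site d`, `ZdEdge d`, `LGConfig d G`); the coarse lattice
  `M ℤ^d` is identified with `ℤ^d` through `blockMap`/`blockBase`, so one RG step is a map
  `LGConfig d G → LGConfig d G` and no tower of lattice spacings is needed (Bałaban rescales to
  the unit lattice after each step; we do not rescale).
* `blockMap` uses `Int` division `x i / M`, which for `0 < M` is floor division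
  (`Int.ediv`); for `M = 0` it is the junk value `0`. Block "centres" are the corners `M y`
  (Bałaban uses cubes centred at `M y`; the combinatorics is identical up to translation).
* Effective densities carry an explicit finite coarse volume `Λ : Finset (ZdEdge d)`: on the
  infinite lattice the Wilson action is infinite, and the UV stability bounds are extensive in
  `|Λ|`. Bałaban works on a torus `T_η`; the free boundary condition (`1` outside the volume) in
  `IsBlockRGStepOf` is a v0 simplification, flagged here.
* `HasUVStability sch k` has the outline's shape `∃ c C, …`; the *uniform* statement needed by
  cqft.S20 is `∃ c C, ∀ k, InWindow sch.couplings γ k → HasUVStabilityBounds sch c C k`, which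
  is why the constants are also exposed as parameters.
* Only `[Group G]`/`[Monoid G]` and `[MeasurableSpace G]` are assumed for the combinatorial
  definitions and for `BlockRGScheme` (outline signature); the Haar reference measure in
  `freeHaarConfig`/`IsBlockRGStepOf` needs the compact-group instances of Wave 0's
  `ConstructiveQFT.haarProbability`.

## Mathlib status

Mathlib (pinned) has no renormalisation group, block-spin map or lattice gauge theory (grep for
`renormali`, `block spin`, `coarse` finds nothing relevant). Anchors used verbatim: `Int` floor
division, `Finset.range`, `Fintype.piFinset`, `List.prod`, `Measure.pi`, `Measure.map`,
`Measure.withDensity`, `ENNReal.ofReal`, Wave 0 `ConstructiveQFT.haarProbability`, G02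
`StatMech.glueWith`.

## References

* T. Bałaban, *Propagators and renormalization transformations for lattice gauge theories. I*,
  CMP 95 (1984) 17–40, §1 (block averaging of gauge fields, axial gauge, (1.4)–(1.6)).
* T. Bałaban, *Averaging operations for lattice gauge theories*, CMP 98 (1985) 17–51, §1.
* T. Bałaban, *Ultraviolet stability of three-dimensional lattice pure gauge field theories*,
  CMP 102 (1985) 255–275, Thm. 1.
* T. Bałaban, *Renormalization group approach to lattice gauge field theories. I*, CMP 109
  (1987) 249–301, (0.1)–(0.3), §1; *II*, CMP 116 (1988) 1–22, (1)–(3).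
* T. Bałaban, *Large field renormalization. II*, CMP 122 (1989) 355–392, Thm. 1 (UV stability
  in `d = 4`).
* J. Dimock, *The renormalization group according to Bałaban. I. Small fields*, Rev. Math.
  Phys. 25 (2013), arXiv:1108.1335, §1.2 (1)–(6).
-/

noncomputable section

open MeasureTheory Finset
open Literature.Probability.LatticeModels

namespace Literature.MathematicalPhysics.QuantumLattice

variable {d N : ℕ} {G : Type*}

/-! ### Blocks of side `M` in `ℤ^d` -/

/-- The block map `x ↦ ⌊x / M⌋` (coordinatewise integer floor division): the site of the coarse
lattice `M ℤ^d ≃ ℤ^d` labelling the block of side `M` containing `x` (Bałaban CMP 95 (1984) §1,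
the blocks `B(y)`). For `M = 0` this is the junk value `0`. [folklore] -/
def blockMap (M : ℕ) (x : Site d) : Site d := fun i => x i / (M : ℤ)

/-- The base corner `M y ∈ ℤ^d` of the block labelled by the coarse site `y` (Bałaban CMP 95
(1984) §1 uses block centres; corners give the same combinatorics up to a translation). [folklore] -/
def blockBase (M : ℕ) (y : Site d) : Site d := fun i => (M : ℤ) * y i

/-- With block size `1` the block map is the identity. [folklore] -/
@[simp] theorem blockMap_one (x : Site d) : blockMap 1 x = x := by
  funext i; simp [blockMap]

/-- With block size `1` the block corner is the identity. [folklore] -/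
@[simp] theorem blockBase_one (y : Site d) : blockBase 1 y = y := by
  funext i; simp [blockBase]

/-- `blockMap` is a left inverse of `blockBase` for `M ≠ 0` (Bałaban CMP 95 (1984) §1). [folklore] -/
@[simp] theorem blockMap_blockBase (M : ℕ) [NeZero M] (y : Site d) :
    blockMap M (blockBase M y) = y := by
  funext i
  simp only [blockMap, blockBase]
  have hM : (M : ℤ) ≠ 0 := by exact_mod_cast NeZero.ne M
  rw [mul_comm, Int.mul_ediv_cancel _ hM]

/-- A site of the block `y`, offset by an integer vector `t` with `0 ≤ t i < M`, is mapped to `y`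
(floor division: `(M yᵢ + tᵢ) / M = yᵢ`). [folklore] -/
theorem blockMap_blockBase_add_of_lt (M : ℕ) (y t : Site d) (h0 : ∀ i, 0 ≤ t i)
    (ht : ∀ i, t i < M) : blockMap M (blockBase M y + t) = y := by
  funext i
  have hM : (M : ℤ) ≠ 0 := by
    have := (h0 i).trans_lt (ht i)
    exact_mod_cast (Nat.pos_of_ne_zero (by rintro rfl; simp at this)).ne'
  simp only [blockMap, blockBase, Pi.add_apply]
  rw [add_comm, Int.add_mul_ediv_left _ _ hM, Int.ediv_eq_zero_of_lt (h0 i) (ht i), zero_add]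

/-- A site of the block `y`, offset by `t ∈ {0, …, M-1}^d` from the corner, is mapped to `y`
(Bałaban CMP 95 (1984) §1, the blocks `B(y)`; immediate from floor division). [folklore] -/
theorem blockMap_blockBase_add (M : ℕ) (y : Site d) (t : Fin d → ℕ) (ht : ∀ i, t i < M) :
    blockMap M (blockBase M y + fun i => (t i : ℤ)) = y :=
  blockMap_blockBase_add_of_lt M y _ (fun i => by positivity) fun i => by exact_mod_cast ht i

/-- The block of side `M` labelled by `y`: the `M ^ d` sites `M y + t`, `t ∈ {0, …, M-1}^d`
(Bałaban CMP 95 (1984) §1, `B(y)`) (Mathlib `Fintype.piFinset`). [folklore] -/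
def blockSites (M : ℕ) (y : Site d) : Finset (Site d) :=
  (Fintype.piFinset fun _ : Fin d => range M).image fun t => blockBase M y + fun i => (t i : ℤ)

/-- Membership in a block is membership in the fibre of `blockMap` (Bałaban CMP 95 (1984) §1:
the blocks partition the lattice; here from `x = M (x / M) + x % M`). [folklore] -/
theorem mem_blockSites_iff (M : ℕ) [NeZero M] (y x : Site d) :
    x ∈ blockSites M y ↔ blockMap M x = y := by
  have hM : (0 : ℤ) < M := by exact_mod_cast Nat.pos_of_ne_zero (NeZero.ne M)
  simp only [blockSites, mem_image, Fintype.mem_piFinset, mem_range]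
  constructor
  · rintro ⟨t, ht, rfl⟩
    exact blockMap_blockBase_add M y t ht
  · rintro rfl
    refine ⟨fun i => (x i % M).toNat, fun i => ?_, ?_⟩
    · show (x i % (M : ℤ)).toNat < M
      have := Int.emod_lt_of_pos (x i) hM
      have h0 := Int.emod_nonneg (x i) hM.ne'
      omega
    · funext i
      simp only [blockBase, blockMap, Pi.add_apply,
        Int.toNat_of_nonneg (Int.emod_nonneg (x i) hM.ne')]
      exact Int.mul_ediv_add_emod (x i) M

/-- A block of side `M` has `M ^ d` sites (Bałaban CMP 95 (1984) §1; `t ↦ M y + t` is injective on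
`{0, …, M-1}^d`, Mathlib `Fintype.card_piFinset_const`). [folklore] -/
theorem card_blockSites (M : ℕ) (y : Site d) : (blockSites M y).card = M ^ d := by
  rw [blockSites, card_image_of_injective, Fintype.card_piFinset_const, card_range]
  intro t t' h
  funext i
  have := congr_fun h i
  simp only [Pi.add_apply, add_right_inj, Nat.cast_inj] at this
  exact this

/-- The coarse edge below the fine edge `(x, i)`: `(⌊x / M⌋, i)` (Bałaban CMP 95 (1984) §1). [folklore] -/
def coarseEdge (M : ℕ) (e : ZdEdge d) : ZdEdge d := (blockMap M e.1, e.2)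

/-- The fine edges lying over the finite set `Λ` of coarse edges: all `(x, i)` with `x` in the
block of `y`, for `(y, i) ∈ Λ` (`M ^ d` fine edges per coarse edge). These are the integration
variables of one block RG step in the coarse volume `Λ` (Bałaban CMP 109 (1987) (0.1)). [folklore] -/
def fineEdges (M : ℕ) (Λ : Finset (ZdEdge d)) : Finset (ZdEdge d) :=
  Λ.biUnion fun b => (blockSites M b.1).image fun x => (x, b.2)

/-- `e` lies over `Λ` iff its coarse edge is in `Λ` (Bałaban CMP 95 (1984) §1; from
`mem_blockSites_iff`). [folklore] -/
theorem mem_fineEdges_iff (M : ℕ) [NeZero M] (Λ : Finset (ZdEdge d)) (e : ZdEdge d) :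
    e ∈ fineEdges M Λ ↔ coarseEdge M e ∈ Λ := by
  simp only [fineEdges, mem_biUnion, mem_image, mem_blockSites_iff]
  constructor
  · rintro ⟨b, hb, x, hx, rfl⟩
    simpa [coarseEdge, hx] using hb
  · intro h
    exact ⟨coarseEdge M e, h, e.1, rfl, rfl⟩

/-! ### Axial-gauge block link variables -/

/-- The straight line of `M` fine edges representing the coarse edge `b = (y, i)`:
`(M y, i), (M y + eᵢ, i), …, (M y + (M-1) eᵢ, i)`, from the corner of the block `y` to the
corner of the block `y + eᵢ` (Bałaban CMP 95 (1984) §1, (1.5): the contour `Γ_{y, y+eᵢ}`). [folklore] -/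
def blockLine (M : ℕ) (b : ZdEdge d) : List (ZdEdge d) :=
  (List.range M).map fun t : ℕ => (blockBase M b.1 + Pi.single b.2 (t : ℤ), b.2)

/-- `blockLine M b` consists of `M` edges. [folklore] -/
@[simp] theorem length_blockLine (M : ℕ) (b : ZdEdge d) : (blockLine M b).length = M := by
  simp [blockLine]

/-- The edges of `blockLine M b` are `(M y + t eᵢ, i)` with `t < M`. [folklore] -/
theorem mem_blockLine_iff (M : ℕ) {b e : ZdEdge d} :
    e ∈ blockLine M b ↔ ∃ t < M, (blockBase M b.1 + Pi.single b.2 (t : ℤ), b.2) = e := by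
  simp [blockLine, List.mem_map, List.mem_range]

/-- Every edge of `blockLine M b` lies over `b` (Bałaban CMP 95 (1984) §1, the contour
`Γ_{y, y+eᵢ}` stays in the block `B(y)`; from `blockMap_blockBase_add_of_lt`). [folklore] -/
theorem coarseEdge_eq_of_mem_blockLine (M : ℕ) {b e : ZdEdge d} (he : e ∈ blockLine M b) :
    coarseEdge M e = b := by
  obtain ⟨t, ht, rfl⟩ := (mem_blockLine_iff M).1 he
  refine Prod.ext ?_ rfl
  refine blockMap_blockBase_add_of_lt M b.1 _ (fun i => ?_) fun i => ?_
  · by_cases hi : i = b.2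
    · subst hi; simp
    · simp [hi]
  · by_cases hi : i = b.2
    · subst hi; simpa using ht
    · have : 0 < M := by omega
      simpa [Pi.single_apply, hi] using this

/-- The edges of `blockLine M b` are among the fine edges over `{b}` (Bałaban CMP 95 (1984)
§1; from `mem_fineEdges_iff` and `coarseEdge_eq_of_mem_blockLine`). [folklore] -/
theorem mem_fineEdges_of_mem_blockLine (M : ℕ) [NeZero M] {b e : ZdEdge d}
    (he : e ∈ blockLine M b) : e ∈ fineEdges M {b} := by
  rw [mem_fineEdges_iff, coarseEdge_eq_of_mem_blockLine M he, mem_singleton]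

section Holonomy

variable [Monoid G]

/-- Bałaban's **axial-gauge block link variable**: the coarse configuration whose value on the
coarse edge `b = (y, i)` is the ordered product `U(My, i) U(My + eᵢ, i) ⋯ U(My + (M-1)eᵢ, i)` of
the fine link variables along the straight line from `M y` to `M (y + eᵢ)`, i.e. the parallel
transport between block corners. In the axial gauge inside blocks this *is* Bałaban's block
average of the gauge field (Bałaban CMP 95 (1984) §1, (1.4)–(1.6); CMP 98 (1985) §1). This is
the honest computable part of the block RG map. [folklore] -/
def axialBlockHolonomy (M : ℕ) (U : LGConfig d G) : LGConfig d G :=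
  fun b => ((blockLine M b).map U).prod

/-- The block holonomy of the trivial configuration is trivial. [folklore] -/
@[simp] theorem axialBlockHolonomy_one (M : ℕ) : axialBlockHolonomy M (1 : LGConfig d G) = 1 := by
  funext b
  simp [axialBlockHolonomy, Pi.one_def]

/-- With block size `1` the block holonomy is the identity (no blocking). [folklore] -/
@[simp] theorem axialBlockHolonomy_one_left (U : LGConfig d G) : axialBlockHolonomy 1 U = U := by
  funext b
  simp [axialBlockHolonomy, blockLine]

/-- The block holonomy on `b` depends only on the fine edges over `{b}` (indeed only on
`blockLine M b`) (Bałaban CMP 95 (1984) §1; Mathlib `DependsOn`, `List.map_congr_left`). [folklore] -/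
theorem isCylinder_axialBlockHolonomy_apply (M : ℕ) [NeZero M] (b : ZdEdge d) :
    IsCylinder (fun U : LGConfig d G => axialBlockHolonomy M U b) (fineEdges M {b}) := by
  intro U V h
  simp only [axialBlockHolonomy]
  rw [List.map_congr_left fun e he => h e (mem_fineEdges_of_mem_blockLine M he)]

end Holonomy

/-- Telescoping of an ordered product of conjugated factors:
`∏_{t<n} aₜ uₜ aₜ₊₁⁻¹ = a₀ (∏_{t<n} uₜ) aₙ⁻¹`. [folklore] -/
theorem prod_range_map_mul_mul_inv [Group G] (a u : ℕ → G) (n : ℕ) :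
    ((List.range n).map fun t => a t * u t * (a (t + 1))⁻¹).prod =
      a 0 * ((List.range n).map u).prod * (a n)⁻¹ := by
  induction n with
  | zero => simp
  | succ n ih =>
    simp only [List.range_succ, List.map_append, List.map_cons, List.map_nil, List.prod_append,
      List.prod_cons, List.prod_nil, mul_one, ih]
    group

/-- The corner of the block `y + eⱼ` is `M y + M eⱼ`. [folklore] -/
theorem blockBase_add_single (M : ℕ) (y : Site d) (j : Fin d) (c : ℤ) :
    blockBase M (y + Pi.single j c) = blockBase M y + Pi.single j ((M : ℤ) * c) := by
  funext i
  by_cases hi : i = j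
  · subst hi; simp [blockBase, mul_add]
  · simp [blockBase, hi]

/-- Gauge covariance of the block holonomy: a fine gauge transformation `g` acts on the block
link variables as the coarse gauge transformation `g ∘ blockBase M` (telescoping of the ordered
product along the straight contour) (Bałaban CMP 95 (1984) §1, (1.7); proved from
`prod_range_map_mul_mul_inv`). [folklore] -/
theorem axialBlockHolonomy_gaugeTransformZd [Group G] (M : ℕ) (g : Site d → G)
    (U : LGConfig d G) :
    axialBlockHolonomy M (gaugeTransformZd g U) =
      gaugeTransformZd (g ∘ blockBase M) (axialBlockHolonomy M U) := by
  funext b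
  obtain ⟨y, j⟩ := b
  have hstep : ∀ t : ℕ, blockBase M y + Pi.single j (t : ℤ) + Pi.single j 1 =
      blockBase M y + Pi.single j ((t + 1 : ℕ) : ℤ) := fun t => by
    rw [add_assoc, ← Pi.single_add, Nat.cast_succ]
  have hL : (blockLine M (y, j)).map (gaugeTransformZd g U) =
      (List.range M).map fun t : ℕ => g (blockBase M y + Pi.single j (t : ℤ)) *
        U (blockBase M y + Pi.single j (t : ℤ), j) *
          (g (blockBase M y + Pi.single j ((t + 1 : ℕ) : ℤ)))⁻¹ := by
    rw [blockLine, List.map_map]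
    exact List.map_congr_left fun t _ => by rw [Function.comp_apply, gaugeTransformZd, hstep]
  have hR : (blockLine M (y, j)).map U =
      (List.range M).map fun t : ℕ => U (blockBase M y + Pi.single j (t : ℤ), j) := by
    rw [blockLine, List.map_map]; rfl
  have key : ((List.range M).map fun t : ℕ => g (blockBase M y + Pi.single j (t : ℤ)) *
        U (blockBase M y + Pi.single j (t : ℤ), j) *
          (g (blockBase M y + Pi.single j ((t + 1 : ℕ) : ℤ)))⁻¹).prod =
      g (blockBase M y + Pi.single j ((0 : ℕ) : ℤ)) *
        ((List.range M).map fun t : ℕ => U (blockBase M y + Pi.single j (t : ℤ), j)).prod *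
          (g (blockBase M y + Pi.single j (M : ℤ)))⁻¹ :=
    prod_range_map_mul_mul_inv (fun t : ℕ => g (blockBase M y + Pi.single j (t : ℤ)))
      (fun t : ℕ => U (blockBase M y + Pi.single j (t : ℤ), j)) M
  change ((blockLine M (y, j)).map (gaugeTransformZd g U)).prod =
    g (blockBase M y) * ((blockLine M (y, j)).map U).prod *
      (g (blockBase M (y + Pi.single j 1)))⁻¹
  rw [hL, hR, key, blockBase_add_single, mul_one, Nat.cast_zero, Pi.single_zero, add_zero]

/-! ### Running couplings and the small-field region -/

/-- The sequence of running (effective) gauge couplings `g_k`, `k ∈ ℕ`, one per RG step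
(Bałaban CMP 109 (1987) (0.3); Dimock arXiv:1108.1335 §1). [cite: arXiv11081335] -/
abbrev RunningCouplings : Type := ℕ → ℝ

/-- The window condition on the running couplings up to step `k`: `0 < g_j ≤ γ` for all `j ≤ k`
(Bałaban CMP 109 (1987) (0.3) and CMP 122 (1989) Thm. 1: "for `g_k` sufficiently small,
uniformly in `k`"). [folklore] -/
def InWindow (g : RunningCouplings) (γ : ℝ) (k : ℕ) : Prop :=
  ∀ j ≤ k, 0 < g j ∧ g j ≤ γ

/-- The window condition is monotone in the step. [folklore] -/
theorem InWindow.mono {g : RunningCouplings} {γ : ℝ} {k l : ℕ} (h : InWindow g γ k) (hlk : l ≤ k) :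
    InWindow g γ l :=
  fun j hj => h j (hj.trans hlk)

/-- The window condition is monotone in the window. [folklore] -/
theorem InWindow.of_le {g : RunningCouplings} {γ γ' : ℝ} {k : ℕ} (h : InWindow g γ k)
    (hγ : γ ≤ γ') : InWindow g γ' k :=
  fun j hj => ⟨(h j hj).1, (h j hj).2.trans hγ⟩

/-- `InWindow g γ (k + 1)` splits off the last coupling. [folklore] -/
theorem inWindow_succ_iff {g : RunningCouplings} {γ : ℝ} {k : ℕ} :
    InWindow g γ (k + 1) ↔ InWindow g γ k ∧ 0 < g (k + 1) ∧ g (k + 1) ≤ γ := by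
  refine ⟨fun h => ⟨h.mono k.le_succ, h _ le_rfl⟩, fun ⟨h, h'⟩ j hj => ?_⟩
  rcases Nat.lt_succ_iff_lt_or_eq.1 (Nat.lt_succ_of_le hj) with hj | rfl
  · exact h j (Nat.lt_succ_iff.1 hj)
  · exact h'

section SmallField

variable [Group G] (ρ : G →* Matrix (Fin N) (Fin N) ℂ)

/-- The **small-field region** on the set of plaquettes `P` with threshold `ε`: configurations
all of whose plaquette variables in `P` are `ε`-close to the identity, measured by the
gauge-invariant quantity `N - Re tr ρ(U_p)` (`= ½ ‖ρ(U_p) - 1‖²_{HS}` for unitary `ρ`)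
(Bałaban CMP 109 (1987) §1, (1.10), `|U(∂p) - 1| < ε_k`; Dimock arXiv:1108.1335 §1.3 for the
scalar analogue). Its complement is the large-field region. [cite: arXiv11081335] -/
def smallFieldRegion (P : Set (ZdPlaquette d)) (ε : ℝ) : Set (LGConfig d G) :=
  {U | ∀ p ∈ P, (N : ℝ) - plaquetteObs ρ p.1 p.2.1.1 p.2.1.2 U ≤ ε}

/-- The small-field region is monotone in the threshold. [folklore] -/
theorem smallFieldRegion_mono {P : Set (ZdPlaquette d)} {ε ε' : ℝ} (h : ε ≤ ε') :
    smallFieldRegion ρ P ε ⊆ smallFieldRegion (G := G) ρ P ε' :=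
  fun _ hU p hp => (hU p hp).trans h

/-- The small-field region is antitone in the set of plaquettes. [folklore] -/
theorem smallFieldRegion_anti {P P' : Set (ZdPlaquette d)} (h : P ⊆ P') (ε : ℝ) :
    smallFieldRegion ρ P' ε ⊆ smallFieldRegion (G := G) ρ P ε :=
  fun _ hU p hp => hU p (h hp)

/-- The trivial configuration is in every small-field region with `ε ≥ 0`
(`Re tr ρ(1) = N`). [folklore] -/
theorem one_mem_smallFieldRegion (P : Set (ZdPlaquette d)) {ε : ℝ} (hε : 0 ≤ ε) :
    (1 : LGConfig d G) ∈ smallFieldRegion ρ P ε := by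
  intro p _
  simp only [plaquetteObs, plaquetteHolonomyZd, Pi.one_apply, inv_one, mul_one, map_one,
    Matrix.trace_one, Fintype.card_fin]
  simpa using hε

/-- The small-field region is gauge invariant (Bałaban CMP 109 (1987) §1). [folklore] -/
theorem gaugeTransformZd_mem_smallFieldRegion_iff (P : Set (ZdPlaquette d)) (ε : ℝ)
    (g : Site d → G) (U : LGConfig d G) :
    gaugeTransformZd g U ∈ smallFieldRegion ρ P ε ↔ U ∈ smallFieldRegion ρ P ε := by
  simp only [smallFieldRegion, Set.mem_setOf_eq, isZdGaugeInvariant_plaquetteObs ρ _ _ _ g U]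

end SmallField

/-! ### One block RG step (free boundary condition) and Bałaban's scheme -/

section Step

variable [Group G] [MeasurableSpace G] [TopologicalSpace G] [IsTopologicalGroup G]
  [CompactSpace G] [BorelSpace G]

/-- The free-boundary reference measure on the finite edge volume `Λ`: product Haar measure on
the edges of `Λ` (Wave 0 `ConstructiveQFT.haarProbability`), glued with the trivial
configuration `1` outside `Λ` (G02 `glueWith`) (Bałaban CMP 109 (1987) (0.1), the measure
`dU = ∏_b dU(b)`; free boundary condition is a v0 simplification of Bałaban's torus). [folklore] -/
def freeHaarConfig (Λ : Finset (ZdEdge d)) : Measure (LGConfig d G) :=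
  (Measure.pi fun _ : ↥Λ => QuantumFieldTheory.haarProbability G).map (glueWith Λ · 1)

/-- `ρk1` is the block RG transform of `ρk` in the coarse edge volume `Λ` with block size `M`
(free boundary condition): the pushforward under `axialBlockHolonomy M` of the measure
`ρk(U) dU` on the fine edges over `Λ` is `ρk1(V) dV` on `Λ`, i.e.
`ρk1(V) = ∫ ∏_{b ∈ Λ} δ(V_b⁻¹ (axialBlockHolonomy M U)_b) ρk(U) dU`
(Bałaban CMP 109 (1987) (0.1)–(0.2); CMP 116 (1988) (1)–(3); Dimock arXiv:1108.1335 (1)–(6) for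
the scalar analogue). Densities are real-valued and enter through `ENNReal.ofReal`. [cite: arXiv11081335] -/
def IsBlockRGStepOf (M : ℕ) (ρk ρk1 : LGConfig d G → ℝ) (Λ : Finset (ZdEdge d)) : Prop :=
  ((freeHaarConfig (fineEdges M Λ)).withDensity fun U => ENNReal.ofReal (ρk U)).map
      (axialBlockHolonomy M) =
    (freeHaarConfig Λ).withDensity fun V => ENNReal.ofReal (ρk1 V)

end Step

section Scheme

-- STUB(v0)
/-- **Bałaban's block renormalisation group scheme** for pure lattice gauge theory with gauge
group `G` in the representation `ρ : G →* M_N(ℂ)` (a hypothesis structure; Bałaban CMP 109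
(1987), 116 (1988), 122 (1989); Dimock arXiv:1108.1335). It bundles the block size `M ≥ 2`,
the running couplings `g_k` and the sequence of effective densities `effDensity k Λ V` after
`k` block RG steps in the finite coarse edge volume `Λ`, starting from the Wilson density
`effDensity 0 Λ U = exp (-(g 0)⁻² S_Λ(U))` (`effDensity_zero`, with A9
`wilsonBoundaryAction`). The RG recursion linking `effDensity (k+1)` to `effDensity k` is the
`STUB(v0)` of this item, see the docstring of `effDensity`. [cite: arXiv11081335] -/
structure BlockRGScheme (d N : ℕ) (G : Type*) [Group G] [MeasurableSpace G] where
  /-- The block size `M` (Bałaban's `L`; CMP 109 (1987) §0). -/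
  M : ℕ
  /-- Blocks are non-trivial: `2 ≤ M`. -/
  two_le_M : 2 ≤ M
  /-- The (unitary) representation defining the Wilson action (Seiler LNP 159 Ch. 1). -/
  ρ : G →* Matrix (Fin N) (Fin N) ℂ
  /-- The running couplings `g_k` (Bałaban CMP 109 (1987) (0.3)). -/
  couplings : RunningCouplings
  /-- STUB(v0): the effective densities `ρ_k(Λ, V)` after `k` block RG steps, in the finite
  coarse edge volume `Λ`, as a function of the coarse field `V`. The real definition is the
  recursion `ρ_{k+1}(V) = ∫ ∏_b δ(V_b⁻¹ Ū_b) χ_k(U) ρ_k(U) dU` with Bałaban's gauge-covariant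
  block average `Ū` (here `axialBlockHolonomy M`, cf. `IsBlockRGStepOf`), the small/large-field
  characteristic functions `χ_k` (cf. `smallFieldRegion`) and the coupling renormalisation
  `g_k ↦ g_{k+1}`; displays to transcribe: Bałaban CMP 109 (1987) (0.1)–(0.3) and §1
  (1.1)–(1.12), CMP 116 (1988) (1)–(3), CMP 122 (1989) Thm. 1, and Dimock arXiv:1108.1335 §1.2
  (1)–(6). In v0 only the starting point `effDensity_zero` is imposed; a future worker adds the
  recursion as a field `effDensity_succ : ∀ k Λ, IsBlockRGStepOf M (effDensity k (fineEdges M Λ))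
  (effDensity (k+1) Λ) Λ` (or its large-field refinement). -/
  effDensity : ℕ → Finset (ZdEdge d) → LGConfig d G → ℝ
  /-- The starting density is the Wilson weight at bare coupling `g_0`:
  `ρ_0(Λ, U) = exp (-(g 0)⁻² S_Λ(U))` (Bałaban CMP 109 (1987) (0.1); Wilson 1974). -/
  effDensity_zero : ∀ (Λ : Finset (ZdEdge d)) (U : LGConfig d G),
    effDensity 0 Λ U = Real.exp (-((couplings 0)⁻¹ ^ 2 * wilsonBoundaryAction ρ Λ U))

namespace BlockRGScheme

variable [Group G] [MeasurableSpace G] (sch : BlockRGScheme d N G)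

/-- The block size of a scheme is non-zero. [folklore] -/
instance neZero_M : NeZero sch.M := ⟨by have := sch.two_le_M; omega⟩

/-- The starting effective density is positive (it is an exponential). [folklore] -/
theorem effDensity_zero_pos (Λ : Finset (ZdEdge d)) (U : LGConfig d G) :
    0 < sch.effDensity 0 Λ U := by
  rw [sch.effDensity_zero]
  exact Real.exp_pos _

/-- The starting effective density of the trivial configuration is `1`: `ρ(1) = 1` has trace `N`,
so the Wilson action of `U = 1` vanishes (Bałaban CMP 109 (1987) (0.1); from `effDensity_zero`). [folklore] -/
theorem effDensity_zero_one (Λ : Finset (ZdEdge d)) : sch.effDensity 0 Λ 1 = 1 := by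
  rw [sch.effDensity_zero]
  have : wilsonBoundaryAction sch.ρ Λ (1 : LGConfig d G) = 0 := by
    refine sum_eq_zero fun p _ => ?_
    simp [plaquetteObs, plaquetteHolonomyZd, Matrix.trace_one, Fintype.card_fin]
  simp [this]

/-- The starting effective density is gauge invariant (Seiler LNP 159 Ch. 1). [folklore] -/
theorem effDensity_zero_gaugeTransformZd (Λ : Finset (ZdEdge d)) (g : Site d → G)
    (U : LGConfig d G) :
    sch.effDensity 0 Λ (gaugeTransformZd g U) = sch.effDensity 0 Λ U := by
  rw [sch.effDensity_zero, sch.effDensity_zero, wilsonBoundaryAction_gaugeTransformZd]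

/-- **Ultraviolet stability bounds** with constants `c, C` up to step `k`: for all `j ≤ k`,
all finite coarse volumes `Λ` and all coarse fields `V`,
`exp (-c |Λ|) ≤ ρ_j(Λ, V) ≤ exp (C |Λ|)` (Bałaban CMP 102 (1985) Thm. 1 for `d = 3`;
CMP 122 (1989) Thm. 1 for `d = 4`: bounds extensive in the volume, uniform in `j`). [folklore] -/
def HasUVStabilityBounds (c C : ℝ) (k : ℕ) : Prop :=
  ∀ j ≤ k, ∀ (Λ : Finset (ZdEdge d)) (V : LGConfig d G),
    Real.exp (-(c * Λ.card)) ≤ sch.effDensity j Λ V ∧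
      sch.effDensity j Λ V ≤ Real.exp (C * Λ.card)

/-- **Ultraviolet stability** up to step `k` (outline shape): there are constants `c, C` with
`HasUVStabilityBounds sch c C k` (Bałaban CMP 102 (1985) Thm. 1; CMP 122 (1989) Thm. 1). The
statement uniform in `k` (cqft.S20) is
`∃ c C, ∀ k, InWindow sch.couplings γ k → sch.HasUVStabilityBounds c C k`. [folklore] -/
def HasUVStability (k : ℕ) : Prop :=
  ∃ c C : ℝ, sch.HasUVStabilityBounds c C k

/-- UV stability bounds are monotone in the step. [folklore] -/
theorem HasUVStabilityBounds.mono {c C : ℝ} {k l : ℕ} (h : sch.HasUVStabilityBounds c C k)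
    (hlk : l ≤ k) : sch.HasUVStabilityBounds c C l :=
  fun j hj => h j (hj.trans hlk)

/-- UV stability is monotone in the step. [folklore] -/
theorem HasUVStability.mono {k l : ℕ} (h : sch.HasUVStability k) (hlk : l ≤ k) :
    sch.HasUVStability l := by
  obtain ⟨c, C, h⟩ := h
  exact ⟨c, C, h.mono sch hlk⟩

/-- Under UV stability bounds the effective densities are positive. [folklore] -/
theorem HasUVStabilityBounds.effDensity_pos {c C : ℝ} {k : ℕ}
    (h : sch.HasUVStabilityBounds c C k) {j : ℕ} (hj : j ≤ k) (Λ : Finset (ZdEdge d))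
    (V : LGConfig d G) : 0 < sch.effDensity j Λ V :=
  (Real.exp_pos _).trans_le (h j hj Λ V).1

end BlockRGScheme

end Scheme

end Literature.MathematicalPhysics.QuantumLattice
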